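import Summits.QuantumFields.YangMills.Theorems.UnitScaleTiltProp7CentreHarmonicDivDictionary
import Summits.QuantumFields.YangMills.Theorems.UnitScaleTiltProp7PinnedFlatCoercivitySrc
import HarnessLib

/-!
# Route `UnitScaleTilt`, crux K1 «MinimiserStabilityRegPr» (stmt-QuantumFields-19200), route-R E′ path (α′), (P-knit) STEP 4 (a) — THE FLAT ζ-ROW OFF THE LINEAR
# FIBRE («INHOM»): for `Δ(∂^*Y) = 0` off the `k`-centres and NO constraint hypothesis,
# `Σ‖∂^*Y‖²_F ≤ (3π⁴/4)·[(2 + 1200N²L⁴/(√L−1)²)·Σ‖∂Y‖²_F + 4·L^{−k}·Σ_c‖(Q^{(k)}Y)(c)‖²_F]` — the defect channel for inputs that sit on the NONLINEAR fibre only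

Cell `ym3-torus`, width seat `ym3-torus-px17` (gen 0; namer ★ym-ust-19200-p1 g14, (P-knit) PLAN 18:07Z, OPEN LIST «P-cov3 — first refusal px17»).  THEOREMS ONLY (0 `def`,
0 `sorry`); `--supports stmt-QuantumFields-19200`, count-neutral.  YM₃ on T³ is a ladder rung (R3), not the Clay problem; nothing here claims the stub, the crux, d = 4 or the gap.

WHY.  In the (α′) knit the slice inequality is applied to `A_H = D‴ − D_Wψ` (STEP 2∕4), and `Q^{(k)}(A_H) = Q^{(k)}(D‴) ≠ 0`: the pinned corrector `ψ` (`ψ|_C = 0`) is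
invisible to the average, but `D‴` is the chart of a point of the EXACT (nonlinear) fibre, so its LINEARISED average is the linearisation defect, of size
`≍ ℓ·‖D‴‖²_∞` per coarse bond — small, not zero.  The unconditional flat ζ-row ✓`Prop7CentreHarmonicDivDictionary.sum_diverg_normSq_le_curl_normSq` (✓p653777 over
the ENGINE ✓p652867) assumes `Q^{(k)}Y = 0` exactly.  This file removes that hypothesis: the constraint split of N7-A read WITH ITS RIGHT-HAND SIDE,
`L^k·(Q_kB)(c) + (φ(c₊) − φ(c₋)) = Λ_B(c₊) − Λ_B(c₋) + (Q^{(k)}Y)(c)`, is ✓`Prop7PinnedFlatCoercivitySrc.exists_constraint_on_hodge_parts_bound_src` (N8, ★routeR-w1), the real core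
✓`Prop7CentreHarmonicDivEngine.sum_coarseDiff_sq_le` already takes arbitrary data `r`, and LEMMA H enters through ✓`hH_of_lemmaH_flat`.  Price of the defect channel:
a factor 2 on the `Λ`-part (600 → 1200) and the new term `4·C_H·L^{−k}·Σ_c‖(Q^{(k)}Y)(c)‖²_F`.

WHAT IS PROVED (ns `…Theorems.Prop7CentreHarmonicDivEngineInhom`; lattice factor `1`, `d = 3`):
* §2 ★ `component_div_bound_inhom` — one real reading with the defect `(Q^{(k)}Y)(c)` kept on the right (N8's split), LEMMA H displayed; `sum_normSq_add_le`;
* §3 ★★ `sum_diverg_normSq_le_curl_add_defect_of_centreHarmonic` (LEMMA H displayed as `hH`), ★★★ `sum_diverg_normSq_le_curl_add_defect` (unconditional, `C_H = 3π⁴/4`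
  by ✓`hH_of_lemmaH_flat`), `…_T3`.
HONEST SCOPE.  Flat, linear bookkeeping; nothing curved; the size of the defect at the knit's `A_H` is the consumer's row (displayed there, not here).

References: T. Bałaban, CMP 95 (1984) 17–40 [Balaban1984PropagatorsI] ((1.18)–(1.21) pp.19–21, Prop. 1.1 (1.90) p.33); CMP 102 (1985) 277–309 [Balaban1985Variational]
(Prop. 7 p.299, (141)–(143)); CMP 99 (1985) 389–434 [Balaban1985BackgroundPropagators] ((3.118)–(3.122) pp.419–420, Thm 3.11 p.416).
-/

set_option autoImplicit false

noncomputable section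

open scoped BigOperators Matrix.Norms.L2Operator Matrix

namespace Summit.QuantumFields.YangMills.Theorems.Prop7CentreHarmonicDivEngineInhom

open Literature.MathematicalPhysics.QuantumFieldTheory.Balaban1983to89
open Finset T4Continuum BlockAveraging LatticeFieldCalculus BlockAveragingEMLLinearised
open B15DeterminingSets (embIter)
open B10StarCount (sum_pbond)
open Summit.QuantumFields.YangMills.Theorems.Prop7PinnedFlatCoercivitySrc (exists_constraint_on_hodge_parts_bound_src)
open Summit.QuantumFields.YangMills.Theorems.Prop7PinnedFlatCoercivity (map_grad map_diverg map_curl map_bondAvgIter exists_reEntry exists_imEntry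
  sum_normSq_le_mul_opNorm_sq sum_normSq_sub_le sum_pbond_tgt_add_src sum_blockEnergy_le sum_grad_normSq_eq_curl_normSq sum_comm₃)
open Summit.QuantumFields.YangMills.Theorems.Prop7CentreHarmonicDivEngine (map_laplace sum_coarseDiff_sq_le)
open Summit.QuantumFields.YangMills.Theorems.Prop7CentreHarmonicDivDictionary (hH_of_lemmaH_flat)

variable {P : Params}

/-! ## §1 (the constraint split of N7-A WITH its right-hand side is ✓`Prop7PinnedFlatCoercivitySrc.exists_constraint_on_hodge_parts_bound_src`, routeR-w1's N8) -/

/-! ## §2 One real reading of the Hodge parts, with the defect and LEMMA H displayed -/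

section Component

variable {N : ℕ}

/-- ★ **ONE READING `π`, INHOMOGENEOUS**: as ✓`Prop7CentreHarmonicDivEngine.component_div_bound` with the data `π(Λ(c₊) − Λ(c₋) + (Q^{(k)}Y)(c))`:
`Σ_x (Δ(π∘φ))(x)² ≤ C_H·(2(L^k)⁻¹·Σ_c π(Λ(c₊) − Λ(c₋) + (Q^{(k)}Y)(c))² + 2·Σ_p π((∂Y)(p))²)`.
[cite: Balaban1984PropagatorsI, Prop. 1.1 (1.90) p.33; Balaban1985Variational, Prop. 7 p.299] -/
theorem component_div_bound_inhom (hd : P.d = 3) {k : ℕ} (hk : k ≤ P.m + P.K) (π : Matrix (Fin N) (Fin N) ℂ →ₗ[ℝ] ℝ)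
    (Q : (i : ℕ) → (PBond P 0 → Matrix (Fin N) (Fin N) ℂ) → PBond P i → Matrix (Fin N) (Fin N) ℂ)
    (Y : PBond P 0 → Matrix (Fin N) (Fin N) ℂ) (φ : Site P 0 → Matrix (Fin N) (Fin N) ℂ) (Λ : Site P k → Matrix (Fin N) (Fin N) ℂ)
    (hcoul : diverg 1 (fun e => Y e - grad 1 φ e) = 0)
    (hC1 : ∀ c : PBond P k, (P.L ^ k : ℕ) • bondAvgIter k (fun e => Y e - grad 1 φ e) c + (φ (embIter k c.tgt) - φ (embIter k c.src))
      = Λ c.tgt - Λ c.src + Q k Y c)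
    {CH : ℝ} (hCH : 0 ≤ CH)
    (hH : ∀ ψ : SiteField P 0 ℝ, (∀ x : Site P 0, x ∉ Set.range (embIter k) → laplace 1 (laplace 1 ψ) x = 0) →
      (P.L : ℝ) ^ k * ∑ x : Site P 0, laplace 1 ψ x ^ 2 ≤ CH * ∑ c : PBond P k, (ψ (embIter k c.tgt) - ψ (embIter k c.src)) ^ 2)
    (hSH : ∀ x : Site P 0, x ∉ Set.range (embIter k) → laplace 1 (laplace 1 (fun y => π (φ y))) x = 0) :
    ∑ x : Site P 0, laplace 1 (fun y => π (φ y)) x ^ 2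
      ≤ CH * (2 * ((P.L : ℝ) ^ k)⁻¹ * ∑ c : PBond P k, π (Λ c.tgt - Λ c.src + Q k Y c) ^ 2 + 2 * ∑ p : Plaq P 0, π (curl 1 Y p) ^ 2) := by
  have hL1 : (1 : ℝ) ≤ P.L := by exact_mod_cast P.L_pos
  set ℓ : ℝ := (P.L : ℝ) ^ k with hℓ
  have hℓ0 : 0 < ℓ := by positivity
  have hdiv : diverg 1 (fun e => π (Y e - grad 1 φ e)) = 0 := by
    funext x
    rw [Pi.zero_apply, ← map_diverg π _ x, congrFun hcoul x, Pi.zero_apply, map_zero]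
  have hC1' : ∀ c : PBond P k, (P.L : ℝ) ^ k * bondAvgIter k (fun e => π (Y e - grad 1 φ e)) c
      + ((fun y => π (φ y)) (embIter k c.tgt) - (fun y => π (φ y)) (embIter k c.src)) = π (Λ c.tgt - Λ c.src + Q k Y c) := by
    intro c
    have hc := congrArg π (hC1 c)
    rw [map_add, map_nsmul, map_bondAvgIter π hk, map_sub, nsmul_eq_mul] at hc
    push_cast at hc
    exact hc
  have hcore := sum_coarseDiff_sq_le hd hk (fun e => π (Y e - grad 1 φ e)) (fun y => π (φ y))
    (fun c => π (Λ c.tgt - Λ c.src + Q k Y c)) hdiv hC1'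
  have hcurl : ∀ p : Plaq P 0, curl 1 (fun e => π (Y e - grad 1 φ e)) p = π (curl 1 Y p) := fun p => by
    rw [← map_curl π _ p]
    exact congrArg π (curl_gaugeShift 1 1 φ Y p)
  simp only [hcurl] at hcore
  have hHπ := hH (fun y => π (φ y)) hSH
  have h1 : ℓ * ∑ x : Site P 0, laplace 1 (fun y => π (φ y)) x ^ 2
      ≤ CH * (2 * ∑ c : PBond P k, π (Λ c.tgt - Λ c.src + Q k Y c) ^ 2 + 2 * ℓ * ∑ p : Plaq P 0, π (curl 1 Y p) ^ 2) :=
    hHπ.trans (mul_le_mul_of_nonneg_left hcore hCH)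
  have h2 : CH * (2 * ∑ c : PBond P k, π (Λ c.tgt - Λ c.src + Q k Y c) ^ 2 + 2 * ℓ * ∑ p : Plaq P 0, π (curl 1 Y p) ^ 2)
      = ℓ * (CH * (2 * ℓ⁻¹ * ∑ c : PBond P k, π (Λ c.tgt - Λ c.src + Q k Y c) ^ 2 + 2 * ∑ p : Plaq P 0, π (curl 1 Y p) ^ 2)) := by
    field_simp
  rw [h2] at h1
  exact le_of_mul_le_mul_left h1 hℓ0

/-- `Σ|a + b|² ≤ 2Σ|a|² + 2Σ|b|²`, entrywise and summed. [folklore] -/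
theorem sum_normSq_add_le (M M' : Matrix (Fin N) (Fin N) ℂ) :
    ∑ a : Fin N, ∑ b : Fin N, Complex.normSq ((M + M') a b)
      ≤ 2 * ∑ a : Fin N, ∑ b : Fin N, Complex.normSq (M a b) + 2 * ∑ a : Fin N, ∑ b : Fin N, Complex.normSq (M' a b) := by
  rw [Finset.mul_sum, Finset.mul_sum, ← Finset.sum_add_distrib]
  refine Finset.sum_le_sum fun a _ => ?_
  rw [Finset.mul_sum, Finset.mul_sum, ← Finset.sum_add_distrib]
  refine Finset.sum_le_sum fun b _ => ?_
  simp only [Matrix.add_apply, Prop7MatrixHodgeSplit.normSq_eq_re_sq_add_im_sq, Complex.add_re, Complex.add_im]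
  nlinarith [sq_nonneg ((M a b).re - (M' a b).re), sq_nonneg ((M a b).im - (M' a b).im)]

end Component

/-! ## §3 The flat ζ-row with the defect channel -/

section Assembly

variable {N : ℕ}

set_option maxHeartbeats 400000 in
/-- ★★ **THE FLAT ζ-ROW OFF THE LINEAR FIBRE, LEMMA H DISPLAYED** (`d = 3`): for an `M_N(ℂ)`-valued bond field `Y` with `Δ(∂^*Y) = 0` off the `k`-centres (NO constraint
hypothesis), any composite `Q^{(k)}` of the linearised average and LEMMA H with constant `C_H ≥ 0`,
`Σ_x ‖(∂^*Y)(x)‖²_F ≤ C_H·[(2 + 1200·N²·L⁴/(√L − 1)²)·Σ_p ‖(∂Y)(p)‖²_F + 4·(L^k)⁻¹·Σ_c ‖(Q^{(k)}Y)(c)‖²_F]`.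
[cite: Balaban1984PropagatorsI, Prop. 1.1 (1.90) p.33, (1.21) p.21; Balaban1985Variational, Prop. 7 p.299, (141)-(143) p.299; Balaban1985BackgroundPropagators, Thm 3.11 p.416] -/
theorem sum_diverg_normSq_le_curl_add_defect_of_centreHarmonic (hd : P.d = 3) [NeZero N]
    (Q : (i : ℕ) → (PBond P 0 → Matrix (Fin N) (Fin N) ℂ) → PBond P i → Matrix (Fin N) (Fin N) ℂ)
    (hQ0 : ∀ Y, Q 0 Y = Y)
    (hQs : ∀ (i : ℕ) (Y : PBond P 0 → Matrix (Fin N) (Fin N) ℂ) (c : PBond P (i + 1)), Q (i + 1) Y c = linAvg (Q i Y) c)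
    (Y : PBond P 0 → Matrix (Fin N) (Fin N) ℂ) {k : ℕ} (hk : k ≤ P.m + P.K)
    (hSH : ∀ x : Site P 0, x ∉ Set.range (embIter k) → laplace 1 (diverg 1 Y) x = 0)
    {CH : ℝ} (hCH : 0 ≤ CH)
    (hH : ∀ ψ : SiteField P 0 ℝ, (∀ x : Site P 0, x ∉ Set.range (embIter k) → laplace 1 (laplace 1 ψ) x = 0) →
      (P.L : ℝ) ^ k * ∑ x : Site P 0, laplace 1 ψ x ^ 2 ≤ CH * ∑ c : PBond P k, (ψ (embIter k c.tgt) - ψ (embIter k c.src)) ^ 2) :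
    ∑ x : Site P 0, ∑ a : Fin N, ∑ b' : Fin N, Complex.normSq ((diverg 1 Y x) a b')
      ≤ CH * ((2 + 1200 * (N : ℝ) ^ 2 * (P.L : ℝ) ^ 4 / (Real.sqrt P.L - 1) ^ 2)
          * ∑ p : Plaq P 0, ∑ a : Fin N, ∑ b' : Fin N, Complex.normSq ((curl 1 Y p) a b')
        + 4 * ((P.L : ℝ) ^ k)⁻¹ * ∑ c : PBond P k, ∑ a : Fin N, ∑ b' : Fin N, Complex.normSq ((Q k Y c) a b')) := by
  classical
  -- the matrix Coulomb gauge and `Δφ = ∂^*Y`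
  obtain ⟨φ, hcoul⟩ := Prop7MatrixHodgeSplit.exists_matrixCoulombGauge Y
  have hlapφ : laplace 1 φ = diverg 1 Y := by
    have h := hcoul
    rw [diverg_sub, diverg_grad] at h
    funext x
    have hx := congrFun h x
    simp only [Pi.zero_apply] at hx
    exact (sub_eq_zero.mp hx).symm
  have hYB : ∀ b : PBond P 0, Y b = (fun e => Y e - grad 1 φ e) b + (φ b.tgt - φ b.src) := fun b => by
    simp only [grad, one_smul, sub_add_cancel]
  -- the inhomogeneous constraint on the Hodge parts
  obtain ⟨Λ, hC1, hC2⟩ := exists_constraint_on_hodge_parts_bound_src hd Q hQ0 hQs Y (fun e => Y e - grad 1 φ e) φ hYB hk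
  -- letters
  have hL1 : (1 : ℝ) < P.L := by exact_mod_cast P.hL.2
  set ℓ : ℝ := (P.L : ℝ) ^ k with hℓ
  have hℓ0 : 0 < ℓ := by positivity
  set CURL : ℝ := ∑ p : Plaq P 0, ∑ a : Fin N, ∑ b' : Fin N, Complex.normSq ((curl 1 Y p) a b') with hCURL
  set DEF : ℝ := ∑ c : PBond P k, ∑ a : Fin N, ∑ b' : Fin N, Complex.normSq ((Q k Y c) a b') with hDEF
  set R : ℝ := ∑ c : PBond P k, ∑ a : Fin N, ∑ b' : Fin N, Complex.normSq ((Λ c.tgt - Λ c.src) a b') with hR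
  set R' : ℝ := ∑ c : PBond P k, ∑ a : Fin N, ∑ b' : Fin N, Complex.normSq ((Λ c.tgt - Λ c.src + Q k Y c) a b') with hR'
  set c₂ : ℝ := (((P.d + 2) * P.L : ℕ) : ℝ) ^ 2 * N * (P.L : ℝ) ^ 2 * ((P.L : ℝ) ^ k / (Real.sqrt P.L - 1) ^ 2) with hc₂
  have hc₂0 : 0 ≤ c₂ := by positivity
  -- the centre-harmonic condition entrywise
  have hSHre : ∀ a b' : Fin N, ∀ x : Site P 0, x ∉ Set.range (embIter k) →
      laplace 1 (laplace 1 (fun y => ((φ y) a b').re)) x = 0 := by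
    intro a b' x hx
    have h0 := hSH x hx
    rw [← hlapφ] at h0
    have h1 : ((laplace 1 (laplace 1 φ) x) a b').re = 0 := by rw [h0]; simp
    rw [Prop7MatrixHodgeSplit.re_laplace_apply] at h1
    have e : (fun y : Site P 0 => ((laplace 1 φ y) a b').re) = laplace 1 (fun y => ((φ y) a b').re) :=
      funext fun y => Prop7MatrixHodgeSplit.re_laplace_apply φ y a b'
    rw [e] at h1
    exact h1
  have hSHim : ∀ a b' : Fin N, ∀ x : Site P 0, x ∉ Set.range (embIter k) →
      laplace 1 (laplace 1 (fun y => ((φ y) a b').im)) x = 0 := by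
    intro a b' x hx
    have h0 := hSH x hx
    rw [← hlapφ] at h0
    have h1 : ((laplace 1 (laplace 1 φ) x) a b').im = 0 := by rw [h0]; simp
    rw [Prop7MatrixHodgeSplit.im_laplace_apply] at h1
    have e : (fun y : Site P 0 => ((laplace 1 φ y) a b').im) = laplace 1 (fun y => ((φ y) a b').im) :=
      funext fun y => Prop7MatrixHodgeSplit.im_laplace_apply φ y a b'
    rw [e] at h1
    exact h1
  -- per entry: §2 for the real and the imaginary reading, summed
  have hent : ∀ a b' : Fin N,
      ∑ x : Site P 0, Complex.normSq ((diverg 1 Y x) a b')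
        ≤ CH * (2 * ℓ⁻¹ * ∑ c : PBond P k, Complex.normSq ((Λ c.tgt - Λ c.src + Q k Y c) a b') + 2 * ∑ p : Plaq P 0, Complex.normSq ((curl 1 Y p) a b')) := by
    intro a b'
    obtain ⟨πr, hπr⟩ := exists_reEntry (N := N) a b'
    obtain ⟨πi, hπi⟩ := exists_imEntry (N := N) a b'
    have hr := component_div_bound_inhom hd hk πr Q Y φ Λ hcoul hC1 hCH hH (by simpa only [hπr] using hSHre a b')
    have hi := component_div_bound_inhom hd hk πi Q Y φ Λ hcoul hC1 hCH hH (by simpa only [hπi] using hSHim a b')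
    simp only [hπr] at hr
    simp only [hπi] at hi
    have eD : ∀ x : Site P 0, Complex.normSq ((diverg 1 Y x) a b')
        = laplace 1 (fun y => ((φ y) a b').re) x ^ 2 + laplace 1 (fun y => ((φ y) a b').im) x ^ 2 := by
      intro x
      rw [← hlapφ, Prop7MatrixHodgeSplit.normSq_eq_re_sq_add_im_sq, Prop7MatrixHodgeSplit.re_laplace_apply,
        Prop7MatrixHodgeSplit.im_laplace_apply]
    simp only [eD, Prop7MatrixHodgeSplit.normSq_eq_re_sq_add_im_sq, Finset.sum_add_distrib]
    nlinarith [hr, hi]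
  have hsum : ∑ x : Site P 0, ∑ a : Fin N, ∑ b' : Fin N, Complex.normSq ((diverg 1 Y x) a b') ≤ CH * (2 * ℓ⁻¹ * R' + 2 * CURL) := by
    rw [sum_comm₃ (fun (x : Site P 0) (a b' : Fin N) => Complex.normSq ((diverg 1 Y x) a b')), hR', hCURL,
      sum_comm₃ (fun (c : PBond P k) (a b' : Fin N) => Complex.normSq ((Λ c.tgt - Λ c.src + Q k Y c) a b')),
      sum_comm₃ (fun (p : Plaq P 0) (a b' : Fin N) => Complex.normSq ((curl 1 Y p) a b'))]
    have step : ∑ a : Fin N, ∑ b' : Fin N, ∑ x : Site P 0, Complex.normSq ((diverg 1 Y x) a b')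
        ≤ ∑ a : Fin N, ∑ b' : Fin N, CH * (2 * ℓ⁻¹ * ∑ c : PBond P k, Complex.normSq ((Λ c.tgt - Λ c.src + Q k Y c) a b')
          + 2 * ∑ p : Plaq P 0, Complex.normSq ((curl 1 Y p) a b')) :=
      Finset.sum_le_sum fun a _ => Finset.sum_le_sum fun b' _ => hent a b'
    refine step.trans (le_of_eq ?_)
    simp only [mul_add, Finset.sum_add_distrib, Finset.mul_sum]
  -- `R' ≤ 2R + 2DEF`
  have hR'le : R' ≤ 2 * R + 2 * DEF := by
    rw [hR', hR, hDEF, Finset.mul_sum, Finset.mul_sum, ← Finset.sum_add_distrib]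
    exact Finset.sum_le_sum fun c _ => sum_normSq_add_le (Λ c.tgt - Λ c.src) (Q k Y c)
  -- `R ≤ 12·N·c₂·CURL` (N7 Step 6b verbatim)
  have hcurlB : ∀ p : Plaq P 0, curl 1 (fun e => Y e - grad 1 φ e) p = curl 1 Y p := fun p => curl_gaugeShift 1 1 φ Y p
  have hRle : R ≤ 12 * N * c₂ * CURL := by
    set Eb : Site P k → ℝ := fun y => ∑ μ : Fin P.d, ∑ ν : Fin P.d, ∑ x ∈ univ.filter (fun x : Site P 0 => Site.proj k k x = y),
        (if Site.proj k k (x.shift ν) = y then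
          ‖(Y ⟨x.shift ν, μ⟩ - grad 1 φ ⟨x.shift ν, μ⟩) - (Y ⟨x, μ⟩ - grad 1 φ ⟨x, μ⟩)‖ ^ 2 else 0) with hEb
    have hC2' : ∀ y : Site P k, ‖Λ y‖ ^ 2 ≤ c₂ * Eb y := fun y => by simpa only [hEb] using hC2 y
    have h1 : ∀ c : PBond P k, ∑ a : Fin N, ∑ b' : Fin N, Complex.normSq ((Λ c.tgt - Λ c.src) a b')
        ≤ 2 * N * c₂ * (Eb c.tgt + Eb c.src) := by
      intro c
      have ht := (sum_normSq_le_mul_opNorm_sq (Λ c.tgt)).trans (mul_le_mul_of_nonneg_left (hC2' c.tgt) (Nat.cast_nonneg N))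
      have hs := (sum_normSq_le_mul_opNorm_sq (Λ c.src)).trans (mul_le_mul_of_nonneg_left (hC2' c.src) (Nat.cast_nonneg N))
      have hsub := sum_normSq_sub_le (Λ c.tgt) (Λ c.src)
      have e1 : (↑N * (c₂ * Eb c.tgt) : ℝ) = N * c₂ * Eb c.tgt := by ring
      have e2 : (↑N * (c₂ * Eb c.src) : ℝ) = N * c₂ * Eb c.src := by ring
      linarith [ht, hs, hsub]
    have h2 := Finset.sum_le_sum fun c (_ : c ∈ (Finset.univ : Finset (PBond P k))) => h1 c
    rw [← Finset.mul_sum, sum_pbond_tgt_add_src Eb, ← hR] at h2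
    have h3 := sum_blockEnergy_le (P := P) (k := k) (fun e => Y e - grad 1 φ e)
    rw [sum_grad_normSq_eq_curl_normSq _ hcoul] at h3
    simp only [hcurlB] at h3
    have h3' : ∑ y : Site P k, Eb y ≤ CURL := by simpa only [hEb, hCURL] using h3
    have hd3 : (P.d : ℝ) = 3 := by exact_mod_cast hd
    rw [hd3] at h2
    have h4 := mul_le_mul_of_nonneg_left h3' (by positivity : (0 : ℝ) ≤ 2 * N * c₂ * (2 * 3))
    linarith [h2, h4]
  -- the constant
  have h5L : (((P.d + 2) * P.L : ℕ) : ℝ) = 5 * P.L := by rw [hd]; push_cast; ring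
  have hCURL0 : 0 ≤ CURL := Finset.sum_nonneg fun _ _ => Finset.sum_nonneg fun _ _ => Finset.sum_nonneg fun _ _ => Complex.normSq_nonneg _
  have hDEF0 : 0 ≤ DEF := Finset.sum_nonneg fun _ _ => Finset.sum_nonneg fun _ _ => Finset.sum_nonneg fun _ _ => Complex.normSq_nonneg _
  have hsq : 0 < (Real.sqrt P.L - 1) ^ 2 := by
    have : 1 < Real.sqrt (P.L : ℝ) := by
      rw [show (1 : ℝ) = Real.sqrt 1 from Real.sqrt_one.symm]
      exact Real.sqrt_lt_sqrt zero_le_one hL1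
    nlinarith
  have hfin : 2 * ℓ⁻¹ * (2 * R) ≤ 1200 * (N : ℝ) ^ 2 * (P.L : ℝ) ^ 4 / (Real.sqrt P.L - 1) ^ 2 * CURL := by
    have h := mul_le_mul_of_nonneg_left hRle (by positivity : (0 : ℝ) ≤ 2 * ℓ⁻¹ * 2)
    have e : 2 * ℓ⁻¹ * (2 * R) = 2 * ℓ⁻¹ * 2 * R := by ring
    rw [e]
    refine h.trans (le_of_eq ?_)
    rw [hc₂, h5L]
    field_simp
    ring
  have hℓi : 0 ≤ ℓ⁻¹ := by positivity
  calc ∑ x : Site P 0, ∑ a : Fin N, ∑ b' : Fin N, Complex.normSq ((diverg 1 Y x) a b')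
      ≤ CH * (2 * ℓ⁻¹ * R' + 2 * CURL) := hsum
    _ ≤ CH * (2 * ℓ⁻¹ * (2 * R + 2 * DEF) + 2 * CURL) := by
        refine mul_le_mul_of_nonneg_left ?_ hCH
        nlinarith [mul_le_mul_of_nonneg_left hR'le (by positivity : (0 : ℝ) ≤ 2 * ℓ⁻¹)]
    _ = CH * ((2 * ℓ⁻¹ * (2 * R) + 2 * CURL) + 4 * ℓ⁻¹ * DEF) := by ring
    _ ≤ CH * ((1200 * (N : ℝ) ^ 2 * (P.L : ℝ) ^ 4 / (Real.sqrt P.L - 1) ^ 2 * CURL + 2 * CURL) + 4 * ℓ⁻¹ * DEF) :=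
        mul_le_mul_of_nonneg_left (by linarith [hfin]) hCH
    _ = CH * ((2 + 1200 * (N : ℝ) ^ 2 * (P.L : ℝ) ^ 4 / (Real.sqrt P.L - 1) ^ 2) * CURL + 4 * ℓ⁻¹ * DEF) := by ring

/-- ★★★ **THE FLAT ζ-ROW OFF THE LINEAR FIBRE, UNCONDITIONAL** (`d = 3`, `C_H = 3π⁴/4` by ✓`hH_of_lemmaH_flat`): for an `M_N(ℂ)`-valued bond field `Y` on the finest torus
with `Δ(∂^*Y) = 0` off the `k`-centres and ANY composite `Q^{(k)}` of the linearised average,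
`Σ_x ‖(∂^*Y)(x)‖²_F ≤ (3π⁴/4)·[(2 + 1200·N²·L⁴/(√L − 1)²)·Σ_p ‖(∂Y)(p)‖²_F + 4·(L^k)⁻¹·Σ_c ‖(Q^{(k)}Y)(c)‖²_F]` — uniformly in `k` and in the volume; at `Q^{(k)}Y = 0`
this is ✓`Prop7CentreHarmonicDivDictionary.sum_diverg_normSq_le_curl_normSq` with the Λ-constant doubled.
[cite: Balaban1984PropagatorsI, Prop. 1.1 (1.90) p.33; Balaban1985Variational, Prop. 7 p.299, (141)-(143) p.299; Balaban1985BackgroundPropagators, Thm 3.11 p.416] -/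
theorem sum_diverg_normSq_le_curl_add_defect (hd : P.d = 3) [NeZero N]
    (Q : (i : ℕ) → (PBond P 0 → Matrix (Fin N) (Fin N) ℂ) → PBond P i → Matrix (Fin N) (Fin N) ℂ)
    (hQ0 : ∀ Y, Q 0 Y = Y)
    (hQs : ∀ (i : ℕ) (Y : PBond P 0 → Matrix (Fin N) (Fin N) ℂ) (c : PBond P (i + 1)), Q (i + 1) Y c = linAvg (Q i Y) c)
    (Y : PBond P 0 → Matrix (Fin N) (Fin N) ℂ) {k : ℕ} (hk : k ≤ P.m + P.K)
    (hSH : ∀ x : Site P 0, x ∉ Set.range (embIter k) → laplace 1 (diverg 1 Y) x = 0) :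
    ∑ x : Site P 0, ∑ a : Fin N, ∑ b' : Fin N, Complex.normSq ((diverg 1 Y x) a b')
      ≤ (3 * Real.pi ^ 4 / 4) * ((2 + 1200 * (N : ℝ) ^ 2 * (P.L : ℝ) ^ 4 / (Real.sqrt P.L - 1) ^ 2)
          * ∑ p : Plaq P 0, ∑ a : Fin N, ∑ b' : Fin N, Complex.normSq ((curl 1 Y p) a b')
        + 4 * ((P.L : ℝ) ^ k)⁻¹ * ∑ c : PBond P k, ∑ a : Fin N, ∑ b' : Fin N, Complex.normSq ((Q k Y c) a b')) :=
  sum_diverg_normSq_le_curl_add_defect_of_centreHarmonic hd Q hQ0 hQs Y hk hSH (by positivity)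
    (fun ψ hψ => hH_of_lemmaH_flat hd hk ψ hψ)

/-- ★ **THE T³ INSTANCE** (run `K` of a T³ family, comparison height `n`, `k = K − n`): the flat ζ-row with the defect channel `4·(3π⁴/4)·L^{−(K−n)}·Σ_c‖(Q^{(K−n)}Y)(c)‖²_F`.
[cite: Balaban1984PropagatorsI, Prop. 1.1 (1.90) p.33; Balaban1985Variational, Prop. 7 p.299] -/
theorem sum_diverg_normSq_le_curl_add_defect_T3 (F : T3ContinuumYM3Torus.T3Family) (K n : ℕ) [NeZero N]
    (Q : (i : ℕ) → (PBond (F.P K) 0 → Matrix (Fin N) (Fin N) ℂ) → PBond (F.P K) i → Matrix (Fin N) (Fin N) ℂ)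
    (hQ0 : ∀ Y, Q 0 Y = Y)
    (hQs : ∀ (i : ℕ) (Y : PBond (F.P K) 0 → Matrix (Fin N) (Fin N) ℂ) (c : PBond (F.P K) (i + 1)), Q (i + 1) Y c = linAvg (Q i Y) c)
    (Y : PBond (F.P K) 0 → Matrix (Fin N) (Fin N) ℂ)
    (hSH : ∀ x : Site (F.P K) 0, x ∉ Set.range (embIter (K - n)) → laplace 1 (diverg 1 Y) x = 0) :
    ∑ x : Site (F.P K) 0, ∑ a : Fin N, ∑ b' : Fin N, Complex.normSq ((diverg 1 Y x) a b')
      ≤ (3 * Real.pi ^ 4 / 4) * ((2 + 1200 * (N : ℝ) ^ 2 * (F.L : ℝ) ^ 4 / (Real.sqrt F.L - 1) ^ 2)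
          * ∑ p : Plaq (F.P K) 0, ∑ a : Fin N, ∑ b' : Fin N, Complex.normSq ((curl 1 Y p) a b')
        + 4 * ((F.L : ℝ) ^ (K - n))⁻¹ * ∑ c : PBond (F.P K) (K - n), ∑ a : Fin N, ∑ b' : Fin N, Complex.normSq ((Q (K - n) Y c) a b')) := by
  have hk : K - n ≤ (F.P K).m + (F.P K).K := by
    have := F.hm
    show K - n ≤ F.m + K
    omega
  exact sum_diverg_normSq_le_curl_add_defect (P := F.P K) (T3ContinuumYM3Torus.T3Family.P_d F K) Q hQ0 hQs Y hk hSH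

end Assembly

end Summit.QuantumFields.YangMills.Theorems.Prop7CentreHarmonicDivEngineInhom

end
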